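import Summits.QuantumAdvantage.QuantumAdvantage.Theorems.CharDialColumnDialB3
import Summits.QuantumAdvantage.QuantumAdvantage.Theorems.CharDialTokenDialT
import Summits.QuantumAdvantage.QuantumAdvantage.Theses.CharDial
import HarnessLib

/-!
# CharDial — the SYMMETRIC-BLOCK LAW (part C): `FrobHardOdd` (32598) ⟺ its RAINBOW RESIDUAL; few-active pure-form strategies lose

Tree twin, part C, of the decomp-qadv lens-5 g34 node `Theses/ColumnDial.lean` (rev1); imports part B3 (the law).  The blocker
`Theses.CharDial.FrobHardOdd` (item 32598; after `ShearDial.frobHardOdd_of_residuals` it is ⟸ 27206 ∧ 27207) splits along the dial into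
piece (A) `SymBlockLawFrob` (strategies WITH a symmetric block of size `m₀(p)`) — ★★ PROVED here from the law (`symBlockLawFrob_holds`) — and
piece (B) `RainbowFrobOdd` (strategies WITHOUT one, for every block size) — the RESIDUAL, undecided; bridge `frobHardOdd_of_pieces` BY NAME,
converses `symBlockLawFrob_of_frobHardOdd` / `rainbowFrobOdd_of_frobHardOdd`, hence ★★ `frobHardOdd_of_rainbow : RainbowFrobOdd → FrobHardOdd`
and `frobHardOdd_iff_rainbow : FrobHardOdd ↔ RainbowFrobOdd`.  §3: for lens-6's pure-form strategies `TokenDial.pureFormY a H`, identical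
coefficient columns on `S` form a symmetric block (`symBlock_of_columns`), `≤ q` non-constant tables on `n ≥ m·p^q` positions force one of
size `m` (`hasSymBlock_of_few_active`, pigeonhole), so ★ `fewActiveFormHard` (every such strategy wins on `≤ (6/7)·2ⁿ` inputs once
`n ≥ m₀(p)·p^q`) and `formHard_symBlock` hold outright.  Kernel-checked, no `sorry`, no instances, no notation.
-/

set_option autoImplicit false
set_option linter.dupNamespace false

namespace Summit.QuantumAdvantage.QuantumAdvantage.Theorems.ColumnDial

open Finset
open Summit.QuantumAdvantage.AdviceFreeQNC0
open Summit.QuantumAdvantage.AdviceFreeQNC0.JLinPeel (TowerDefs.FormHard TokenDial.pureFormY)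

/-! ### §1 The two pieces of `CharDial.FrobHardOdd` cut by the symmetric-block dial -/

/-- piece (A): `FrobHardOdd` restricted to strategies WITH a symmetric block of size `m₀(p)`.  [T-implied: `symBlockLawFrob_of_frobHardOdd`; ★ PROVED: `symBlockLawFrob_holds`] -/
def SymBlockLawFrob : Prop :=
  ∀ (p : ℕ) [Fact p.Prime], 5 ≤ p → ∃ m₀ : ℕ, ∃ θ : ℝ, θ < 1 ∧ ∃ n₀ : ℕ, ∀ n ≥ n₀, ∀ c : ℕ,
    ∀ y : Fin (n + 1) → (Fin n → Bool) → Bool, (∀ g, HasDegF p (y g) (p - 1)) → HasSymBlock p m₀ y →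
      ((univ.filter fun u : Fin n → Bool => ringWinU c y u = true).card : ℝ) ≤ θ * (2 : ℝ) ^ n

/-- piece (B), the RAINBOW RESIDUAL: `FrobHardOdd` restricted, for every block size `m`, to strategies WITHOUT a symmetric block of size `m`.
[T-implied: `rainbowFrobOdd_of_frobHardOdd`; UNDECIDED; `⟺ FrobHardOdd`: `frobHardOdd_iff_rainbow` — THE RESIDUAL of item 32598] -/
def RainbowFrobOdd : Prop :=
  ∀ (p : ℕ) [Fact p.Prime], 5 ≤ p → ∀ m : ℕ, ∃ θ : ℝ, θ < 1 ∧ ∃ n₀ : ℕ, ∀ n ≥ n₀, ∀ c : ℕ,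
    ∀ y : Fin (n + 1) → (Fin n → Bool) → Bool, (∀ g, HasDegF p (y g) (p - 1)) → ¬ HasSymBlock p m y →
      ((univ.filter fun u : Fin n → Bool => ringWinU c y u = true).card : ℝ) ≤ θ * (2 : ℝ) ^ n

/-! ### §2 The bridge BY NAME, piece (A) from the law, and `FrobHardOdd ⟺ RainbowFrobOdd` -/

/-- a prime `p ≥ 5` is coprime to `3`. -/
theorem coprime_three_of_prime {p : ℕ} [hp : Fact p.Prime] (h5 : 5 ≤ p) : Nat.Coprime p 3 :=
  (Nat.coprime_primes hp.out Nat.prime_three).mpr (by omega)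

/-- ★★ piece (A) HOLDS, with `θ = 6/7` and no `n₀`: the symmetric-block law `ColumnDial.symBlockLaw` specialised to primes `p ≥ 5`
(the degree hypothesis is not used). -/
theorem symBlockLawFrob_holds : SymBlockLawFrob := by
  intro p hp h5
  obtain ⟨m₀, h⟩ := symBlockLaw p (by omega) (coprime_three_of_prime h5)
  exact ⟨m₀, 6 / 7, by norm_num, 0, fun n _ c y _ hS => h n c y hS⟩

/-- ★ **the bridge**: the two pieces give the blocker `CharDial.FrobHardOdd` (item 32598). -/
theorem frobHardOdd_of_pieces (hA : SymBlockLawFrob) (hB : RainbowFrobOdd) :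
    Summit.QuantumAdvantage.QuantumAdvantage.Theses.CharDial.FrobHardOdd := by
  intro p _ hp
  obtain ⟨m₀, θ₁, hθ₁, n₁, h₁⟩ := hA p hp
  obtain ⟨θ₂, hθ₂, n₂, h₂⟩ := hB p hp m₀
  refine ⟨max θ₁ θ₂, max_lt hθ₁ hθ₂, max n₁ n₂, fun n hn c y hy => ?_⟩
  have h2 : (0 : ℝ) ≤ (2 : ℝ) ^ n := by positivity
  by_cases hS : HasSymBlock p m₀ y
  · exact (h₁ n (le_of_max_le_left hn) c y hy hS).trans (mul_le_mul_of_nonneg_right (le_max_left _ _) h2)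
  · exact (h₂ n (le_of_max_le_right hn) c y hy hS).trans (mul_le_mul_of_nonneg_right (le_max_right _ _) h2)

/-- converse: `T` implies piece (A) (drop the block hypothesis) — (A) is a CONSEQUENCE of `T`. -/
theorem symBlockLawFrob_of_frobHardOdd (hT : Summit.QuantumAdvantage.QuantumAdvantage.Theses.CharDial.FrobHardOdd) : SymBlockLawFrob := by
  intro p _ hp
  obtain ⟨θ, hθ, n₀, h⟩ := hT p hp
  exact ⟨0, θ, hθ, n₀, fun n hn c y hy _ => h n hn c y hy⟩

/-- converse: `T` implies piece (B) — (B) is a CONSEQUENCE of `T`; with (A) a theorem, (B) `≡ T`. -/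
theorem rainbowFrobOdd_of_frobHardOdd (hT : Summit.QuantumAdvantage.QuantumAdvantage.Theses.CharDial.FrobHardOdd) : RainbowFrobOdd := by
  intro p _ hp m
  obtain ⟨θ, hθ, n₀, h⟩ := hT p hp
  exact ⟨θ, hθ, n₀, fun n hn c y hy _ => h n hn c y hy⟩

/-- ★★ **item 32598 from its rainbow residual ALONE**: `RainbowFrobOdd → CharDial.FrobHardOdd` (piece (A) discharged by the law). -/
theorem frobHardOdd_of_rainbow (hB : RainbowFrobOdd) :
    Summit.QuantumAdvantage.QuantumAdvantage.Theses.CharDial.FrobHardOdd :=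
  frobHardOdd_of_pieces symBlockLawFrob_holds hB

/-- ★★ hence `CharDial.FrobHardOdd` (32598) is EQUIVALENT to its rainbow residual. -/
theorem frobHardOdd_iff_rainbow :
    Summit.QuantumAdvantage.QuantumAdvantage.Theses.CharDial.FrobHardOdd ↔ RainbowFrobOdd :=
  ⟨rainbowFrobOdd_of_frobHardOdd, frobHardOdd_of_rainbow⟩

/-! ### §3 What the law decides outright: identical columns, few active cuts -/

section Columns

variable {n p : ℕ}

/-- the linear form of a cut splits off the block: identical coefficients `α` on `S` contribute `α · wt_S`. -/
theorem form_split (S : Finset (Fin n)) (a : Fin n → ZMod p) (α : ZMod p) (ha : ∀ i ∈ S, a i = α) (u : Fin n → Bool) :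
    (∑ i, if u i then a i else 0) = (∑ i ∈ univ \ S, if u i then a i else 0) + α * ((SubChar.bw S u : ℕ) : ZMod p) := by
  classical
  rw [← Finset.sum_sdiff (Finset.subset_univ S)]
  congr 1
  have h : ∀ i ∈ S, (if u i then a i else 0) = if u i = true then α else 0 := by
    intro i hi; rw [ha i hi]
  rw [Finset.sum_congr rfl h, Finset.sum_ite, Finset.sum_const_zero, add_zero, Finset.sum_const, nsmul_eq_mul, mul_comm]
  rfl

/-- ★ IDENTICAL COLUMNS ARE A SYMMETRIC BLOCK: if every cut's coefficient vector is constant on `S` (cuts with a constant table excused),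
the pure-form strategy has the symmetric block `S`. -/
theorem symBlock_of_columns (S : Finset (Fin n)) (a : Fin (n + 1) → Fin n → ZMod p) (H : Fin (n + 1) → ZMod p → Bool)
    (hcol : ∀ g, (∃ α, ∀ i ∈ S, a g i = α) ∨ (∀ s t, H g s = H g t)) :
    SymBlock p S (TokenDial.pureFormY a H) := by
  classical
  intro g u v huv hbw
  rcases hcol g with ⟨α, hα⟩ | hconst
  · show H g _ = H g _
    rw [form_split S (a g) α hα u, form_split S (a g) α hα v, hbw]
    congr 2
    refine Finset.sum_congr rfl fun i hi => ?_
    rw [huv i (Finset.mem_sdiff.1 hi).2]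
  · exact hconst _ _

/-- ★ PIGEONHOLE: if all cuts outside a set `A` of at most `q` cuts have constant tables («at most `q` active cuts») and `n ≥ m · p^q`,
then `m` positions carry identical active columns, hence form a symmetric block of size `m`. -/
theorem hasSymBlock_of_few_active [NeZero p] (m q : ℕ) (a : Fin (n + 1) → Fin n → ZMod p) (H : Fin (n + 1) → ZMod p → Bool)
    (A : Finset (Fin (n + 1))) (hq : A.card ≤ q) (hA : ∀ g, g ∉ A → ∀ s t, H g s = H g t) (hn : m * p ^ q ≤ n) (hp : 1 ≤ p) :
    HasSymBlock p m (TokenDial.pureFormY a H) := by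
  classical
  -- the active column of a position
  let col : Fin n → (A → ZMod p) := fun i g => a g.1 i
  by_cases hm : m = 0
  · exact ⟨∅, by simp [hm], symBlock_of_columns ∅ a H fun g => Or.inl ⟨0, by simp⟩⟩
  have hcardβ : Fintype.card (A → ZMod p) ≤ p ^ q := by
    rw [Fintype.card_fun, ZMod.card, Fintype.card_coe]
    exact Nat.pow_le_pow_right hp hq
  -- some column value is taken at least `m` times
  obtain ⟨γ, hγ⟩ : ∃ γ : A → ZMod p, m ≤ (univ.filter fun i : Fin n => col i = γ).card := by
    by_contra hcon
    push Not at hcon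
    have hsum : (univ : Finset (Fin n)).card = ∑ γ : A → ZMod p, (univ.filter fun i : Fin n => col i = γ).card := by
      rw [← Finset.card_eq_sum_card_fiberwise (f := col) (s := univ) (t := univ) fun _ _ => Finset.mem_univ _]
    have hlt : (univ : Finset (Fin n)).card < Fintype.card (A → ZMod p) * m := by
      rw [hsum]
      calc ∑ γ : A → ZMod p, (univ.filter fun i : Fin n => col i = γ).card
          < ∑ _γ : A → ZMod p, m := Finset.sum_lt_sum_of_nonempty ⟨fun _ => 0, Finset.mem_univ _⟩ fun γ _ => hcon γ
        _ = Fintype.card (A → ZMod p) * m := by rw [Finset.sum_const, smul_eq_mul, Finset.card_univ]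
    rw [Finset.card_univ, Fintype.card_fin] at hlt
    have : n < p ^ q * m := lt_of_lt_of_le hlt (Nat.mul_le_mul_right m hcardβ)
    rw [mul_comm] at this
    omega
  refine ⟨univ.filter fun i : Fin n => col i = γ, hγ, symBlock_of_columns _ a H fun g => ?_⟩
  by_cases hg : g ∈ A
  · refine Or.inl ⟨γ ⟨g, hg⟩, fun i hi => ?_⟩
    have hi' := (Finset.mem_filter.1 hi).2
    exact congrFun hi' ⟨g, hg⟩
  · exact Or.inr (hA g hg)

/-- FEW-ACTIVE HARDNESS for pure-form strategies: for every bound `q` on the number of cuts with a non-constant table, eventually a loss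
of `≥ 1/7`. -/
def FewActiveFormHard : Prop :=
  ∀ (p : ℕ) [Fact p.Prime], 5 ≤ p → ∀ q : ℕ, ∃ n₀ : ℕ, ∀ n ≥ n₀, ∀ c : ℕ,
    ∀ (a : Fin (n + 1) → Fin n → ZMod p) (H : Fin (n + 1) → ZMod p → Bool),
      (∃ A : Finset (Fin (n + 1)), A.card ≤ q ∧ ∀ g, g ∉ A → ∀ s t, H g s = H g t) →
      ((univ.filter fun u : Fin n → Bool => ringWinU c (TokenDial.pureFormY a H) u = true).card : ℝ) ≤ (6 / 7 : ℝ) * (2 : ℝ) ^ n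

/-- ★ FEW-ACTIVE HARDNESS HOLDS (threshold `n₀ = m₀(p)·p^q`, by the law and the pigeonhole). -/
theorem fewActiveFormHard : FewActiveFormHard := by
  intro p hp h5 q
  obtain ⟨m₀, h⟩ := symBlockLaw p (by omega) (coprime_three_of_prime h5)
  haveI : NeZero p := ⟨hp.out.ne_zero⟩
  refine ⟨m₀ * p ^ q, fun n hn c a H hq => h n c _ ?_⟩
  obtain ⟨A, hAq, hA⟩ := hq
  exact hasSymBlock_of_few_active m₀ q a H A hAq hA hn hp.out.one_lt.le

/-- the symmetric-block part of lens-6's pure-form core `TowerDefs.FormHard` holds outright (θ = 6/7, no `n₀`). -/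
theorem formHard_symBlock :
    ∀ (p : ℕ) [Fact p.Prime], 5 ≤ p → ∃ m₀ : ℕ, ∀ (n c : ℕ) (a : Fin (n + 1) → Fin n → ZMod p) (H : Fin (n + 1) → ZMod p → Bool),
      HasSymBlock p m₀ (TokenDial.pureFormY a H) →
        ((univ.filter fun u : Fin n → Bool => ringWinU c (TokenDial.pureFormY a H) u = true).card : ℝ) ≤ (6 / 7 : ℝ) * (2 : ℝ) ^ n := by
  intro p hp h5
  obtain ⟨m₀, h⟩ := symBlockLaw p (by omega) (coprime_three_of_prime h5)
  exact ⟨m₀, fun n c a H hS => h n c _ hS⟩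

end Columns

end Summit.QuantumAdvantage.QuantumAdvantage.Theorems.ColumnDial
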